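import Summits.Schanuel.Schanuel.Theorems.RootDecomp1BFedFlagCore
import Summits.Schanuel.Schanuel.Theses.RootDecomp1B

/-!
# RootDecomp1B — round 7 in place (PATH A′): the route-level flag steps imply the fed coupling

Landed AFTER writer-1's round-7 edit (PATH A′-N, revs 17–18, 2026-08-30T08:47Z) created the route constants `FedSharpStep`
(stmt-Schanuel-31200) and `FedSurplusOneStep` (stmt-Schanuel-31201); there is no `FedFlagReduction` item on this path, so the
file is a plain rung `--supports stmt-Schanuel-31200` (port of lens-4 g7 `prover/RootDecomp1BFedFlagReduction.port.lean` by the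
census seat, prover role).

* `baseFedCoupling_of_flag_steps : FedSharpStep → FedSurplusOneStep → BaseFedCoupling` over the ROUTE constants
  (`--supports stmt-Schanuel-30165`; the round-7 cut is then recorded between ledger items, as
  `RootDecomp1BAutonomySplit` records round 6);
* `flag_steps_of_kleinPolarSchanuel` : the converse (exactness of round 7 at route level).

The route constants and the core file's local statements have the same bodies; Lean identifies them by unfolding.
This file defines nothing; no transcendence input; 0 sorry.
-/

set_option linter.dupNamespace false

namespace Summit.Schanuel.Schanuel.Theorems.RootDecomp1BFedFlagReduction

open Summit.Schanuel.Schanuel.Theses.RootDecomp1B (FedSharpStep FedSurplusOneStep BaseFedCoupling KleinPolarSchanuel)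

/-- Route-level `FedSharpStep ∧ FedSurplusOneStep` ⟹ Klein-polar Schanuel at every fed tuple under the induction
hypothesis (the core kernel `fedKleinPolar_of_flag_steps`, route constants identified with the core's local copies). -/
theorem fedKleinPolar_of_route_flag_steps (hS : FedSharpStep) (h1 : FedSurplusOneStep) :
    RootDecomp1BFedFlagCore.FedKleinPolar := by
  intro m r hr ih hF
  exact RootDecomp1BFedFlagCore.fedKleinPolar_of_flag_steps hS h1 m r hr ih hF

/-- THE ROUND-7 CUT BETWEEN LEDGER ITEMS: `FedSharpStep → FedSurplusOneStep → BaseFedCoupling` (30165). -/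
theorem baseFedCoupling_of_flag_steps (hS : FedSharpStep) (h1 : FedSurplusOneStep) : BaseFedCoupling := by
  intro m r hr hIH _ _ _ _ hfed _
  exact RootDecomp1BFedFlagCore.fedKleinPolar_of_flag_steps hS h1 m r hr hIH hfed

/-- Converse direction (exactness of round 7 at route level): Klein-polar Schanuel implies both flag steps. -/
theorem flag_steps_of_kleinPolarSchanuel (hK : KleinPolarSchanuel) : FedSharpStep ∧ FedSurplusOneStep := by
  have hF : RootDecomp1BFedFlagCore.FedKleinPolar := fun m r hr _ _ => hK m r hr
  exact ⟨fun m r hr ih hL hd => RootDecomp1BFedFlagCore.fedSharpStep_of_fedKleinPolar hF m r hr ih hL hd,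
    fun m r hr ih hL hd => RootDecomp1BFedFlagCore.fedSurplusOneStep_of_fedKleinPolar hF m r hr ih hL hd⟩

end Summit.Schanuel.Schanuel.Theorems.RootDecomp1BFedFlagReduction
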